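import Literature.Analysis.FunctionSpaces.TorusDiffMonomials
import Literature.Analysis.FunctionSpaces.TorusL4Interpolation
import HarnessLib

/-!
# `L²` bounds for differential monomials: one factor in `L²`, the others in `L^∞`

Analysis/FunctionSpaces support file (everything proved; no definitions, no named facts). The
per-term estimate of the `H^m` energy method for first-order quasilinear systems with only `C¹`
control (Majda 1984, Ch. 2 §2.1, proof of Thm 2.2 — the continuation principle): a commutator
term of the `m`-th order energy inequality is a proper differential monomial
`T = γ(W) · ∂^{v₁}W ⋯ ∂^{v_r}W` (`Torus.DiffMonomial`, file `TorusDiffMonomials`) with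

  `r ≥ 2`,  `|v_l| ≥ 1`,  `|v₁| + ⋯ + |v_r| = m + 1`,  `max |v_l| ≤ m`,

and `‖T‖_{L²}` is bounded LINEARLY in the unknown top-order quantities by putting the factor
of maximal order in `L²` and the others in `L^∞`. With `C¹` control (`|∂^{≤1} W| ≤ S`) and the
inductive information at level `m` (`|∂^{≤ m-3} W| ≤ S` in sup, `‖∂^{≤ m-1} W‖₂ ≤ B`), the unknown
quantities are `X = max ‖∂^{≤ m}W‖₂` and `Ξ = max |∂^{m-2}W|` (the latter `≲ X` by Sobolev), and
the elementary trichotomy `DiffMonomial.shape_trichotomy` on the orders shows that every term is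
of one of three kinds: all non-maximal factors of order `≤ max(1, m-3)` (bound `G S^{r-1} X`);
`m ∈ {4, 5}` with exactly one non-maximal factor of order `m - 2` and then the maximal order is
`≤ m - 1` (bound `G S^{r-2} Ξ B`); or `m = 3` and `T = γ ∂²W ∂²W`, bounded by `3 G S X` through
Nirenberg's `L⁴` interpolation (`Torus.integral_mul_partialDeriv_partialDeriv_sq_le`, file
`TorusL4Interpolation`). The outcome is `DiffMonomial.sqrt_integral_eval_sq_le`:

  `‖T‖_{L²} ≤ G · S^r · (3 X + B Ξ)`.

Also recorded: the triangle inequality for `f ↦ (∫ f²)^{1/2}` over finite lists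
(`sqrt_integral_list_sum_sq_le`), used to sum the per-term bounds over an expansion.

## References

* A. Majda, *Compressible Fluid Flow and Systems of Conservation Laws in Several Space
  Variables*, Springer 1984, Ch. 2 §2.1, Prop. 2.1 and proof of Thm 2.2. [Majda1984]
* M. E. Taylor, *Partial Differential Equations III*, 2nd ed., Springer 2011, Ch. 13 §3
  (Moser estimates), Ch. 16 §1. [TaylorPDEIII2011]
-/

noncomputable section

open MeasureTheory Set Function
open scoped ContDiff

namespace Literature.Analysis.FunctionSpaces

namespace Torus

variable {d : Type*} [Fintype d] [DecidableEq d] {κ : Type*}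

/-! ### `L²` bookkeeping for continuous functions on the torus -/

omit [DecidableEq d] in
/-- **Cauchy–Schwarz** for continuous real functions on the torus: `(∫ f g)² ≤ (∫ f²)(∫ g²)`
(the discriminant of `t ↦ ∫ (f - t g)² ≥ 0`). [folklore] -/
theorem sq_integral_mul_le {f g : UnitAddTorus d → ℝ} (hf : Continuous f) (hg : Continuous g) :
    (∫ x, f x * g x) ^ 2 ≤ (∫ x, f x ^ 2) * ∫ x, g x ^ 2 := by
  have hff : Integrable (fun x => f x ^ 2) := (hf.pow 2).integrable_unitAddTorus
  have hgg : Integrable (fun x => g x ^ 2) := (hg.pow 2).integrable_unitAddTorus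
  have hfg : Integrable (fun x => f x * g x) := (hf.mul hg).integrable_unitAddTorus
  have hquad : ∀ t : ℝ, 0 ≤ (∫ x, g x ^ 2) * (t * t) + (-2 * ∫ x, f x * g x) * t + ∫ x, f x ^ 2 := by
    intro t
    have h0 : 0 ≤ ∫ x, (f x - t * g x) ^ 2 := integral_nonneg fun x => sq_nonneg _
    have hexp : ∫ x, (f x - t * g x) ^ 2 =
        (∫ x, g x ^ 2) * (t * t) + (-2 * ∫ x, f x * g x) * t + ∫ x, f x ^ 2 := by
      have h1 : (fun x => (f x - t * g x) ^ 2) =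
          fun x => f x ^ 2 + ((-2 * t) * (f x * g x) + t ^ 2 * g x ^ 2) := by
        funext x; ring
      have hrest : Integrable (fun x => (-2 * t) * (f x * g x) + t ^ 2 * g x ^ 2) := by
        exact (hfg.const_mul (-2 * t)).add (hgg.const_mul (t ^ 2))
      rw [h1, integral_add hff hrest, integral_add (hfg.const_mul _) (hgg.const_mul _),
        integral_const_mul, integral_const_mul]
      ring
    rw [hexp] at h0
    exact h0
  have hdisc := discrim_le_zero hquad
  rw [discrim] at hdisc
  nlinarith [hdisc]

omit [DecidableEq d] in
/-- `∫ f g ≤ √(∫ f²) √(∫ g²)` for continuous `f, g`. [folklore] -/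
theorem integral_mul_le_sqrt_mul_sqrt {f g : UnitAddTorus d → ℝ} (hf : Continuous f) (hg : Continuous g) :
    ∫ x, f x * g x ≤ Real.sqrt (∫ x, f x ^ 2) * Real.sqrt (∫ x, g x ^ 2) := by
  have h := sq_integral_mul_le hf hg
  have hf0 : 0 ≤ ∫ x, f x ^ 2 := integral_nonneg fun x => sq_nonneg _
  rw [← Real.sqrt_mul hf0]
  calc ∫ x, f x * g x ≤ |∫ x, f x * g x| := le_abs_self _
    _ = Real.sqrt ((∫ x, f x * g x) ^ 2) := (Real.sqrt_sq_eq_abs _).symm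
    _ ≤ Real.sqrt ((∫ x, f x ^ 2) * ∫ x, g x ^ 2) := Real.sqrt_le_sqrt h

omit [DecidableEq d] in
/-- **Triangle inequality for `(∫ f²)^{1/2}`** (continuous `f, g`). [folklore] -/
theorem sqrt_integral_add_sq_le {f g : UnitAddTorus d → ℝ} (hf : Continuous f) (hg : Continuous g) :
    Real.sqrt (∫ x, (f x + g x) ^ 2) ≤ Real.sqrt (∫ x, f x ^ 2) + Real.sqrt (∫ x, g x ^ 2) := by
  have hff : Integrable (fun x => f x ^ 2) := (hf.pow 2).integrable_unitAddTorus
  have hgg : Integrable (fun x => g x ^ 2) := (hg.pow 2).integrable_unitAddTorus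
  have hfg : Integrable (fun x => f x * g x) := (hf.mul hg).integrable_unitAddTorus
  have hF0 : 0 ≤ ∫ x, f x ^ 2 := integral_nonneg fun x => sq_nonneg _
  have hG0 : 0 ≤ ∫ x, g x ^ 2 := integral_nonneg fun x => sq_nonneg _
  have hexp : ∫ x, (f x + g x) ^ 2 = (∫ x, f x ^ 2) + 2 * (∫ x, f x * g x) + ∫ x, g x ^ 2 := by
    have h1 : (fun x => (f x + g x) ^ 2) = fun x => f x ^ 2 + (2 * (f x * g x) + g x ^ 2) := by
      funext x; ring
    have hrest : Integrable (fun x => 2 * (f x * g x) + g x ^ 2) := by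
      exact (hfg.const_mul 2).add hgg
    rw [h1, integral_add hff hrest, integral_add (hfg.const_mul _) hgg, integral_const_mul]
    ring
  have hCS := integral_mul_le_sqrt_mul_sqrt hf hg
  rw [Real.sqrt_le_left (by positivity), hexp]
  nlinarith [Real.sq_sqrt hF0, Real.sq_sqrt hG0, Real.sqrt_nonneg (∫ x, f x ^ 2),
    Real.sqrt_nonneg (∫ x, g x ^ 2)]

omit [DecidableEq d] in
/-- Triangle inequality for `(∫ f²)^{1/2}` over a finite list of continuous functions. [folklore] -/
theorem sqrt_integral_list_sum_sq_le {α : Type*} (l : List α) {F : α → UnitAddTorus d → ℝ}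
    (hF : ∀ s ∈ l, Continuous (F s)) :
    Real.sqrt (∫ x, ((l.map fun s => F s x).sum) ^ 2) ≤
      (l.map fun s => Real.sqrt (∫ x, F s x ^ 2)).sum := by
  induction l with
  | nil => simp
  | cons s l ih =>
    have hs : Continuous (F s) := hF s List.mem_cons_self
    have hl : ∀ s' ∈ l, Continuous (F s') := fun s' hs' => hF s' (List.mem_cons_of_mem _ hs')
    have hsum : Continuous fun x => (l.map fun s => F s x).sum := continuous_list_sum l hl
    simp only [List.map_cons, List.sum_cons]
    exact (sqrt_integral_add_sq_le hs hsum).trans (by gcongr; exact ih hl)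

omit [DecidableEq d] in
/-- **`L^∞ × L² → L²`**: `∫ (a b)² ≤ A² ∫ b²` when `|a| ≤ A`. [folklore] -/
theorem integral_sq_mul_le_of_abs_le {a b : UnitAddTorus d → ℝ} (hb : Continuous b) {A : ℝ}
    (hA : ∀ x, |a x| ≤ A) : ∫ x, (a x * b x) ^ 2 ≤ A ^ 2 * ∫ x, b x ^ 2 := by
  have hbb : Integrable (fun x => b x ^ 2) := (hb.pow 2).integrable_unitAddTorus
  rw [← integral_const_mul]
  refine integral_mono_of_nonneg (Filter.Eventually.of_forall fun x => sq_nonneg _)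
    (hbb.const_mul _) (Filter.Eventually.of_forall fun x => ?_)
  show (a x * b x) ^ 2 ≤ A ^ 2 * b x ^ 2
  have h1 : (a x * b x) ^ 2 = a x ^ 2 * b x ^ 2 := by ring
  rw [h1]
  exact mul_le_mul_of_nonneg_right (by
    calc a x ^ 2 = |a x| ^ 2 := (sq_abs _).symm
      _ ≤ A ^ 2 := pow_le_pow_left₀ (abs_nonneg _) (hA x) 2) (sq_nonneg _)

omit [DecidableEq d] in
/-- `√(∫ (a b)²) ≤ A √(∫ b²)` when `|a| ≤ A`, `A ≥ 0`. [folklore] -/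
theorem sqrt_integral_sq_mul_le_of_abs_le {a b : UnitAddTorus d → ℝ} (hb : Continuous b) {A : ℝ}
    (hA0 : 0 ≤ A) (hA : ∀ x, |a x| ≤ A) :
    Real.sqrt (∫ x, (a x * b x) ^ 2) ≤ A * Real.sqrt (∫ x, b x ^ 2) := by
  rw [← Real.sqrt_sq hA0, ← Real.sqrt_mul (sq_nonneg _)]
  exact Real.sqrt_le_sqrt (integral_sq_mul_le_of_abs_le hb hA)

namespace DiffMonomial

/-! ### Sup bounds for products of factors -/

omit [Fintype d] in
/-- A product of factors each bounded by `S ≥ 0` is bounded by `S^{length}`. [folklore] -/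
theorem abs_prodEval_le_pow {φ : κ → UnitAddTorus d → ℝ} {S : ℝ} (hS0 : 0 ≤ S) :
    ∀ (l : List (List d × κ)), (∀ f ∈ l, ∀ x, |iterPartialDeriv f.1 (φ f.2) x| ≤ S) →
      ∀ x, |prodEval φ l x| ≤ S ^ l.length
  | [], _, x => by simp
  | f :: l, h, x => by
    rw [prodEval_cons, abs_mul, List.length_cons, pow_succ, mul_comm (S ^ l.length)]
    exact mul_le_mul (h f List.mem_cons_self x)
      (abs_prodEval_le_pow hS0 l (fun f' hf' => h f' (List.mem_cons_of_mem _ hf')) x)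
      (abs_nonneg _) hS0

omit [Fintype d] [DecidableEq d] in
/-- If every factor has a nonempty word, `length ≤ orderOf`. [folklore] -/
theorem length_le_orderOf : ∀ {l : List (List d × κ)}, (∀ f ∈ l, f.1 ≠ []) → l.length ≤ orderOf l
  | [], _ => by simp
  | f :: l, h => by
    have hf : 1 ≤ f.1.length := by
      have := h f List.mem_cons_self
      rcases hv : f.1 with _ | ⟨i, v⟩
      · exact absurd hv this
      · simp
    have ih := length_le_orderOf (l := l) fun f' hf' => h f' (List.mem_cons_of_mem _ hf')
    simp only [List.length_cons, orderOf_cons]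
    omega

omit [Fintype d] [DecidableEq d] in
/-- Every factor order is at most `orderOf`. [folklore] -/
theorem length_le_orderOf_of_mem : ∀ {l : List (List d × κ)} {f : List d × κ}, f ∈ l → f.1.length ≤ orderOf l
  | [], _, h => by simp at h
  | f' :: l, f, h => by
    simp only [orderOf_cons]
    rcases List.mem_cons.1 h with rfl | h'
    · omega
    · have := length_le_orderOf_of_mem h'
      omega

/-! ### The trichotomy of shapes -/

omit [Fintype d] [DecidableEq d] in
/-- **Shape trichotomy** for the non-maximal factors of a proper monomial of order `m + 1`,
width `≥ 2` and maximal order `o⋆ ≤ m` (`m ≥ 2`): either all non-maximal factors have order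
`≤ max 1 (m - 3)`; or `m ≥ 4`, `o⋆ ≤ m - 1` and exactly one non-maximal factor has order `m - 2`,
the rest having order `≤ max 1 (m - 3)`; or `m = 3`, `o⋆ = 2` and there is a single non-maximal
factor, of order `2`. [cite: Majda1984, Ch. 2 §2.1 Thm 2.2] -/
theorem shape_trichotomy {others : List (List d × κ)} {ostar m : ℕ} (hm : 2 ≤ m)
    (hge : ∀ f ∈ others, f.1 ≠ []) (hle : ∀ f ∈ others, f.1.length ≤ ostar)
    (hsum : orderOf others + ostar = m + 1) (hostar : ostar ≤ m) :
    (∀ f ∈ others, f.1.length ≤ max 1 (m - 3)) ∨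
    (4 ≤ m ∧ ostar ≤ m - 1 ∧ ∃ (l₁ : List (List d × κ)) (f' : List d × κ) (l₂ : List (List d × κ)),
      others = l₁ ++ f' :: l₂ ∧ f'.1.length = m - 2 ∧ ∀ f ∈ l₁ ++ l₂, f.1.length ≤ max 1 (m - 3)) ∨
    (m = 3 ∧ ostar = 2 ∧ ∃ f' : List d × κ, others = [f'] ∧ f'.1.length = 2) := by
  by_cases hall : ∀ f ∈ others, f.1.length ≤ max 1 (m - 3)
  · exact Or.inl hall
  push Not at hall
  obtain ⟨f', hf', hgt⟩ := hall
  obtain ⟨l₁, l₂, rfl⟩ := List.append_of_mem hf'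
  have ho' := hle f' hf'
  have h1 : 1 < f'.1.length := lt_of_le_of_lt (le_max_left _ _) hgt
  have h2 : m - 3 < f'.1.length := lt_of_le_of_lt (le_max_right _ _) hgt
  have hsum' : orderOf l₁ + (f'.1.length + orderOf l₂) + ostar = m + 1 := by
    rw [orderOf_append, orderOf_cons] at hsum; exact hsum
  have hl₁ : ∀ f ∈ l₁, f.1 ≠ [] := fun f hf => hge f (List.mem_append_left _ hf)
  have hl₂ : ∀ f ∈ l₂, f.1 ≠ [] := fun f hf =>
    hge f (List.mem_append_right _ (List.mem_cons_of_mem _ hf))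
  have hlen₁ := length_le_orderOf hl₁
  have hlen₂ := length_le_orderOf hl₂
  right
  by_cases hm3 : m = 3
  · -- `m = 3`: both big factors have order two and nothing else is left
    subst hm3
    right
    have e₁ : l₁ = [] := List.eq_nil_of_length_eq_zero (by omega)
    have e₂ : l₂ = [] := List.eq_nil_of_length_eq_zero (by omega)
    subst e₁; subst e₂
    exact ⟨rfl, by omega, f', by simp, by simp at hsum'; omega⟩
  · -- `m ∈ {4, 5}`
    left
    refine ⟨by omega, by omega, l₁, f', l₂, rfl, by omega, fun f hf => ?_⟩
    have hsmall : orderOf l₁ + orderOf l₂ ≤ 1 := by omega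
    rcases List.mem_append.1 hf with h | h
    · have := length_le_orderOf_of_mem h
      exact (le_max_left 1 (m - 3)).trans' (by omega)
    · have := length_le_orderOf_of_mem h
      exact (le_max_left 1 (m - 3)).trans' (by omega)

/-! ### The per-term `L²` bound -/

omit [Fintype d] in
/-- Words of length two are iterated partial derivatives `∂ⱼ∂ᵢ`. [folklore] -/
theorem iterPartialDeriv_pair (j i : d) (f : UnitAddTorus d → ℝ) :
    iterPartialDeriv [j, i] f = partialDeriv j (partialDeriv i f) := by
  simp [iterPartialDeriv_cons]

/-- **The per-term bound of the `H^m` energy method** (Majda 1984, proof of Thm 2.2): for a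
proper monomial `T` of width `r ≥ 2`, order `m + 1 ≥ 3` and maximal factor order `≤ m` in smooth
fields `φ`, with `|coefficient| ≤ G` along the fields, sup bounds `S ≥ 1` on all words of length
`≤ max 1 (m-3)`, `Ξ` on words of length `m - 2`, and `L²` bounds `B` on words of length `≤ m - 1`,
`X` on words of length `≤ m`:  `‖eval T‖_{L²} ≤ G S^r (3X + B Ξ)`.
[cite: Majda1984, Ch. 2 §2.1 Thm 2.2] -/
theorem sqrt_integral_eval_sq_le {φ : κ → UnitAddTorus d → ℝ} (hφ : ∀ k, IsSmooth (φ k)) {a b : κ}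
    {T : DiffMonomial d κ} (hTp : T.Proper) (hTw : 2 ≤ T.width) {m : ℕ} (hm : 2 ≤ m)
    (hTo : T.order = m + 1) (hTmax : T.maxOrder ≤ m)
    {G : ℝ} (hG0 : 0 ≤ G) (hG : ∀ x, |T.coeff (φ a x) (φ b x)| ≤ G)
    {S : ℝ} (hS1 : 1 ≤ S)
    (hS : ∀ (k : κ) (v : List d), v.length ≤ max 1 (m - 3) → ∀ x, |iterPartialDeriv v (φ k) x| ≤ S)
    {Ξ : ℝ} (hΞ0 : 0 ≤ Ξ)
    (hΞ : ∀ (k : κ) (v : List d), v.length = m - 2 → ∀ x, |iterPartialDeriv v (φ k) x| ≤ Ξ)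
    {B : ℝ} (hB0 : 0 ≤ B)
    (hB : ∀ (k : κ) (v : List d), v.length ≤ m - 1 →
      Real.sqrt (∫ x, iterPartialDeriv v (φ k) x ^ 2) ≤ B)
    {X : ℝ} (hX0 : 0 ≤ X)
    (hX : ∀ (k : κ) (v : List d), v.length ≤ m →
      Real.sqrt (∫ x, iterPartialDeriv v (φ k) x ^ 2) ≤ X) :
    Real.sqrt (∫ x, eval φ a b T x ^ 2) ≤ G * S ^ T.width * (3 * X + B * Ξ) := by
  have hS0 : 0 ≤ S := zero_le_one.trans hS1
  -- the factor of maximal order and the others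
  have hne : T.factors ≠ [] := by
    intro h; simp [width, h] at hTw
  obtain ⟨fs, hfs, hfse⟩ := exists_length_eq_maxOrder T hne
  obtain ⟨pre, post, hsplit⟩ := List.append_of_mem hfs
  set ostar := T.maxOrder with hostar_def
  have hmemT : ∀ f ∈ pre ++ post, f ∈ T.factors := by
    intro f hf
    rw [hsplit]
    rcases List.mem_append.1 hf with h | h
    · exact List.mem_append_left _ h
    · exact List.mem_append_right _ (List.mem_cons_of_mem _ h)
  have hge : ∀ f ∈ pre ++ post, f.1 ≠ [] := fun f hf => hTp f (hmemT f hf)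
  have hle : ∀ f ∈ pre ++ post, f.1.length ≤ ostar := fun f hf => length_le_maxOrder (hmemT f hf)
  have hsum : orderOf (pre ++ post) + ostar = m + 1 := by
    have h := hTo
    rw [order_eq, hsplit, orderOf_append, orderOf_cons, hfse] at h
    rw [orderOf_append]; omega
  have hwidth : T.width = (pre ++ post).length + 1 := by
    simp only [width, hsplit, List.length_append, List.length_cons]; omega
  -- the evaluation, factorised
  have hsmooth_fs : IsSmooth (iterPartialDeriv fs.1 (φ fs.2)) := (hφ fs.2).iterPartialDeriv fs.1
  have heval : ∀ x, eval φ a b T x =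
      (T.coeff (φ a x) (φ b x) * prodEval φ (pre ++ post) x) * iterPartialDeriv fs.1 (φ fs.2) x := by
    intro x
    rw [eval_def, hsplit, prodEval_append, prodEval_cons, prodEval_append]; ring
  have hevalfun : (fun x => eval φ a b T x ^ 2) = fun x =>
      ((T.coeff (φ a x) (φ b x) * prodEval φ (pre ++ post) x) * iterPartialDeriv fs.1 (φ fs.2) x) ^ 2 := by
    funext x; rw [heval x]
  -- `S`-powers
  have hSpow : ∀ {p q : ℕ}, p ≤ q → S ^ p ≤ S ^ q := fun h => pow_le_pow_right₀ hS1 h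
  have h3XB : X ≤ 3 * X + B * Ξ := by nlinarith [mul_nonneg hB0 hΞ0]
  rcases shape_trichotomy hm hge hle hsum hTmax with hC1 | ⟨hm4, hom1, l₁, f', l₂, hofs, hf'len, hrest⟩ |
      ⟨hm3, ho2, f', hofs, hf'len⟩
  · -- Case 1: all the other factors in sup with `S`, the maximal one in `L²` with `X`
    have hsup : ∀ x, |T.coeff (φ a x) (φ b x) * prodEval φ (pre ++ post) x| ≤ G * S ^ (pre ++ post).length := by
      intro x
      rw [abs_mul]
      exact mul_le_mul (hG x) (abs_prodEval_le_pow hS0 _ (fun f hf y => hS f.2 f.1 (hC1 f hf) y) x)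
        (abs_nonneg _) hG0
    calc Real.sqrt (∫ x, eval φ a b T x ^ 2)
        ≤ (G * S ^ (pre ++ post).length) * Real.sqrt (∫ x, iterPartialDeriv fs.1 (φ fs.2) x ^ 2) := by
          rw [hevalfun]
          exact sqrt_integral_sq_mul_le_of_abs_le hsmooth_fs.continuous (by positivity) hsup
      _ ≤ (G * S ^ (pre ++ post).length) * X :=
          mul_le_mul_of_nonneg_left (hX fs.2 fs.1 (by rw [hfse]; exact hTmax)) (by positivity)
      _ ≤ G * S ^ T.width * (3 * X + B * Ξ) := by
          rw [hwidth]
          exact mul_le_mul (mul_le_mul_of_nonneg_left (hSpow (Nat.le_succ _)) hG0) h3XB hX0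
            (by positivity)
  · -- Case 2: one other factor of order `m - 2` in sup with `Ξ`, the maximal one in `L²` with `B`
    have hsup : ∀ x, |T.coeff (φ a x) (φ b x) * prodEval φ (pre ++ post) x| ≤
        G * (S ^ l₁.length * (Ξ * S ^ l₂.length)) := by
      intro x
      rw [abs_mul, hofs, prodEval_append, prodEval_cons, abs_mul, abs_mul]
      refine mul_le_mul (hG x) ?_ (by positivity) hG0
      refine mul_le_mul (abs_prodEval_le_pow hS0 _ (fun f hf y => hS f.2 f.1
        (hrest f (List.mem_append_left _ hf)) y) x) ?_ (by positivity) (by positivity)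
      exact mul_le_mul (hΞ f'.2 f'.1 hf'len x) (abs_prodEval_le_pow hS0 _ (fun f hf y => hS f.2 f.1
        (hrest f (List.mem_append_right _ hf)) y) x) (abs_nonneg _) hΞ0
    have hlen : l₁.length + l₂.length + 2 = T.width := by
      rw [hwidth, hofs]; simp only [List.length_append, List.length_cons]; omega
    calc Real.sqrt (∫ x, eval φ a b T x ^ 2)
        ≤ (G * (S ^ l₁.length * (Ξ * S ^ l₂.length))) *
            Real.sqrt (∫ x, iterPartialDeriv fs.1 (φ fs.2) x ^ 2) := by
          rw [hevalfun]
          exact sqrt_integral_sq_mul_le_of_abs_le hsmooth_fs.continuous (by positivity) hsup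
      _ ≤ (G * (S ^ l₁.length * (Ξ * S ^ l₂.length))) * B :=
          mul_le_mul_of_nonneg_left (hB fs.2 fs.1 (by rw [hfse]; exact hom1)) (by positivity)
      _ = G * S ^ (l₁.length + l₂.length) * (B * Ξ) := by rw [pow_add]; ring
      _ ≤ G * S ^ T.width * (3 * X + B * Ξ) := by
          refine mul_le_mul (mul_le_mul_of_nonneg_left (hSpow (by omega)) hG0) (by nlinarith)
            (by positivity) (by positivity)
  · -- Case 3 (`m = 3`): `γ · ∂²φ · ∂²ψ`, by the `L⁴` interpolation inequality
    subst hm3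
    have hpp : pre ++ post = [f'] := hofs
    obtain ⟨j, i, hij⟩ := List.length_eq_two.1 hf'len
    have hfs2 : fs.1.length = 2 := by rw [hfse]; exact ho2
    obtain ⟨l, k, hlk⟩ := List.length_eq_two.1 hfs2
    have hsmooth_f' : IsSmooth (iterPartialDeriv f'.1 (φ f'.2)) := (hφ f'.2).iterPartialDeriv f'.1
    have hevalfun' : (fun x => eval φ a b T x ^ 2) = fun x =>
        (T.coeff (φ a x) (φ b x) * (partialDeriv j (partialDeriv i (φ f'.2)) x *
          partialDeriv l (partialDeriv k (φ fs.2)) x)) ^ 2 := by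
      funext x
      rw [heval x, hpp]
      simp only [prodEval_cons, prodEval_nil, mul_one, hij, hlk, iterPartialDeriv_pair]
      ring
    have hA : ∀ x, |partialDeriv i (φ f'.2) x| ≤ S := fun x => by
      have := hS f'.2 [i] (by simp) x
      simpa [iterPartialDeriv_cons] using this
    have hA' : ∀ x, |partialDeriv k (φ fs.2) x| ≤ S := fun x => by
      have := hS fs.2 [k] (by simp) x
      simpa [iterPartialDeriv_cons] using this
    have hGN := integral_mul_partialDeriv_partialDeriv_sq_le (hφ f'.2) (hφ fs.2) i j k l hA hA'
    have hP : Real.sqrt (∫ x, partialDeriv j (partialDeriv j (partialDeriv i (φ f'.2))) x ^ 2) ≤ X := by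
      have := hX f'.2 [j, j, i] (by simp) 
      simpa [iterPartialDeriv_cons] using this
    have hQ : Real.sqrt (∫ x, partialDeriv l (partialDeriv l (partialDeriv k (φ fs.2))) x ^ 2) ≤ X := by
      have := hX fs.2 [l, l, k] (by simp)
      simpa [iterPartialDeriv_cons] using this
    have hcont : Continuous fun x => partialDeriv j (partialDeriv i (φ f'.2)) x *
        partialDeriv l (partialDeriv k (φ fs.2)) x :=
      (((hφ f'.2).partialDeriv i).partialDeriv j).continuous.mul
        (((hφ fs.2).partialDeriv k).partialDeriv l).continuous
    have hinner : Real.sqrt (∫ x, (partialDeriv j (partialDeriv i (φ f'.2)) x *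
        partialDeriv l (partialDeriv k (φ fs.2)) x) ^ 2) ≤ 3 * S * X := by
      rw [Real.sqrt_le_left (by positivity)]
      calc ∫ x, (partialDeriv j (partialDeriv i (φ f'.2)) x * partialDeriv l (partialDeriv k (φ fs.2)) x) ^ 2
          ≤ 9 * S * S * (Real.sqrt (∫ x, partialDeriv j (partialDeriv j (partialDeriv i (φ f'.2))) x ^ 2) *
              Real.sqrt (∫ x, partialDeriv l (partialDeriv l (partialDeriv k (φ fs.2))) x ^ 2)) := hGN
        _ ≤ 9 * S * S * (X * X) :=
            mul_le_mul_of_nonneg_left (mul_le_mul hP hQ (Real.sqrt_nonneg _) hX0) (by positivity)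
        _ = (3 * S * X) ^ 2 := by ring
    have hw2 : T.width = 2 := by rw [hwidth, hpp]; rfl
    calc Real.sqrt (∫ x, eval φ a b T x ^ 2)
        ≤ G * Real.sqrt (∫ x, (partialDeriv j (partialDeriv i (φ f'.2)) x *
            partialDeriv l (partialDeriv k (φ fs.2)) x) ^ 2) := by
          rw [hevalfun']
          exact sqrt_integral_sq_mul_le_of_abs_le hcont hG0 hG
      _ ≤ G * (3 * S * X) := mul_le_mul_of_nonneg_left hinner hG0
      _ = G * S ^ 1 * (3 * X) := by ring
      _ ≤ G * S ^ T.width * (3 * X + B * Ξ) := by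
          rw [hw2]
          exact mul_le_mul (mul_le_mul_of_nonneg_left (hSpow (by norm_num)) hG0)
            (by nlinarith [mul_nonneg hB0 hΞ0]) (by positivity) (by positivity)

end DiffMonomial

end Torus

end Literature.Analysis.FunctionSpaces

end
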